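import Literature.MathematicalPhysics.StatisticalMechanics.LennardJonesClusters
import Literature.MathematicalPhysics.StatisticalMechanics.MiePotential
import Mathlib.Analysis.Complex.ExponentialBounds
import HarnessLib

/-!
# Route `BrittleRungDescent`, support item `LadderGroundStates` (stmt-AtomisticToContinuum-10945):
# the `(1 - 2/q)`-separation of ground states high on the Mie ladder

Helper file (the separation half of `LadderGroundStates`; independent of the two existence
helpers). For `q ≥ 500`, every ground state of
the Mie rung `V_q = miePotential q` (`V_q(r) = r^{-2q}/(2q) - r^{-q}/q`) in `ℝ³` has all its
interparticle distances `≥ 1 - 2/q` (`le_dist_of_isGroundState_miePotential`). The proof is the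
removal-plus-packing argument of `LennardJonesMinimalDistance_holds` (Xue 1997 / Blanc 2004 /
Blanc–Lewin 2015, §2.2), run twice. Write `u_k = |x_{i₀} - x_k|^{-q}`, so that
`2q V_q(|x_{i₀} - x_k|) = u_k² - 2u_k`, and let `(i₀, j₀)` be a closest pair, `r = |x_{i₀} - x_{j₀}|`,
`u₀ = r^{-q}`.

1. Removal (`siteEnergy_nonpos`): `∑_{k ≠ i₀} (u_k² - 2 u_k) ≤ 0`.
2. Crude bound: by the shell sum `sum_inv_pow_six_le`, `∑_k u_k ≤ r^{-(q-6)} ∑_k |x_{i₀} - x_k|⁻⁶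
   ≤ 250 u₀`, whence `u₀² ≤ 500 u₀`, `u₀ ≤ 500`, and `r ≥ 49/50` since `(50/49)^q ≥ 1024`.
3. Refined bound: if `r < 1 - 2/q` then `r^q < (1 - 2/q)^q ≤ e⁻² < 1/7`, so `u₀ > 7` and
   `u₀² - 2u₀ > 35`; every other `k` contributes `≥ -1` if `|x_{i₀} - x_k| ≤ 26/25` (at most
   `(2 · (26/25)/r + 1)³ - 2 ≤ 28.45` such `k`, packing) and `≥ -2u_k ≥ -2 (25/26)^{q-6}
   |x_{i₀} - x_k|⁻⁶` otherwise (total `≤ 500 (25/26)^{q-6} r⁻⁶ ≤ 2.21`); contradiction.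
-/

noncomputable section

open scoped BigOperators Topology
open Metric Set Filter Module

namespace Summit.AtomisticToContinuum.Crystallization.Theorems

open Literature.MathematicalPhysics.StatisticalMechanics

namespace LadderGroundStates

variable {V : ℝ → ℝ} {c : ℝ} {d N : ℕ}

/-- **Removal inequality.** In a ground state of a potential bounded below and `≤ 0` on `[1, ∞)`,
every particle has non-positive site energy `∑_{k ≠ i} V(|xᵢ - x_k|) ≤ 0`: moving `xᵢ` to a point
at distance `≥ 1` from all particles yields a configuration of distinct points, whose energy is
`≥ E(N)` (the argument of `siteEnergy_nonpos_of_isGroundState` for Lennard-Jones). [folklore] -/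
theorem siteEnergy_nonpos (hd : 0 < d) (hc : ∀ r, c ≤ V r) (hV1 : ∀ s, 1 ≤ s → V s ≤ 0)
    {x : Fin N → EuclideanSpace ℝ (Fin d)} (hx : IsGroundState V x) (i : Fin N) :
    siteEnergy V x i ≤ 0 := by
  -- a far point `y`
  set a : ℝ := 1 + ∑ k, ‖x k‖ with ha
  set y : EuclideanSpace ℝ (Fin d) := EuclideanSpace.single (⟨0, hd⟩ : Fin d) a with hy_def
  have ha0 : 0 ≤ a := add_nonneg zero_le_one (Finset.sum_nonneg fun k _ => norm_nonneg (x k))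
  have hyn : ‖y‖ = a := by simp [hy_def, abs_of_nonneg ha0]
  have hy : ∀ k, 1 ≤ dist y (x k) := fun k => by
    have h1 : ‖x k‖ ≤ ∑ l, ‖x l‖ :=
      Finset.single_le_sum (f := fun l => ‖x l‖) (fun l _ => norm_nonneg _) (Finset.mem_univ k)
    have h2 : ‖y‖ - ‖x k‖ ≤ dist y (x k) := by rw [dist_eq_norm]; exact norm_sub_norm_le y (x k)
    linarith
  have hy' : ∀ k, y ≠ x k := fun k h => by
    have := hy k
    rw [h, dist_self] at this
    exact absurd this (by norm_num)
  -- the modified configuration consists of distinct points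
  have hinj : Function.Injective (Function.update x i y) := by
    intro a b hab
    by_cases ha : a = i <;> by_cases hb : b = i
    · exact ha.trans hb.symm
    · subst ha
      rw [Function.update_self, Function.update_of_ne hb] at hab
      exact absurd hab (hy' b)
    · subst hb
      rw [Function.update_self, Function.update_of_ne ha] at hab
      exact absurd hab.symm (hy' a)
    · rw [Function.update_of_ne ha, Function.update_of_ne hb] at hab
      exact hx.1 hab
  have hle : interactionEnergy V x ≤ interactionEnergy V (Function.update x i y) := by
    rw [hx.2]
    exact groundStateEnergy_le_of_le V hc hinj
  have hdiff := sum_siteEnergy_update_sub V x i y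
  have hneg : ∑ k ∈ Finset.univ.erase i, V (dist y (x k)) ≤ 0 :=
    Finset.sum_nonpos fun k _ => hV1 _ (hy k)
  have h2 := two_mul_interactionEnergy V x
  have h2' := two_mul_interactionEnergy V (Function.update x i y)
  linarith

/-- `V_q ≤ 0` on `[1, ∞)` (`q ≠ 0`): `V_q(1) = -1/(2q) < 0` and `V_q < 0` beyond `1`
(`miePotential_neg`). [folklore] -/
theorem miePotential_nonpos {q : ℕ} (hq : q ≠ 0) {s : ℝ} (hs : 1 ≤ s) : miePotential q s ≤ 0 := by
  rcases hs.eq_or_lt with rfl | hs'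
  · rw [miePotential_one hq]
    have : (0 : ℝ) < 2 * (q : ℝ) := by positivity
    exact (div_neg_of_neg_of_pos (by norm_num) this).le
  · exact (miePotential_neg hq hs').le

/-! ## Numerical facts -/

/-- `(50/49)^q ≥ 1024` for `q ≥ 490` (`(50/49)^49 ≥ 2`). [folklore] -/
theorem le_pow_fifty_div (q : ℕ) (hq : 490 ≤ q) : (1024 : ℝ) ≤ (50 / 49 : ℝ) ^ q := by
  have h1 : (2 : ℝ) ≤ (50 / 49 : ℝ) ^ 49 := by norm_num
  calc (1024 : ℝ) = 2 ^ 10 := by norm_num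
    _ ≤ ((50 / 49 : ℝ) ^ 49) ^ 10 := pow_le_pow_left₀ (by norm_num) h1 10
    _ = (50 / 49 : ℝ) ^ 490 := by rw [← pow_mul]
    _ ≤ (50 / 49 : ℝ) ^ q := pow_le_pow_right₀ (by norm_num) hq

/-- `(26/25)^m ≥ 256` for `m ≥ 200` (`(26/25)^25 ≥ 2`). [folklore] -/
theorem le_pow_twentySix_div (m : ℕ) (hm : 200 ≤ m) : (256 : ℝ) ≤ (26 / 25 : ℝ) ^ m := by
  have h1 : (2 : ℝ) ≤ (26 / 25 : ℝ) ^ 25 := by norm_num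
  calc (256 : ℝ) = 2 ^ 8 := by norm_num
    _ ≤ ((26 / 25 : ℝ) ^ 25) ^ 8 := pow_le_pow_left₀ (by norm_num) h1 8
    _ = (26 / 25 : ℝ) ^ 200 := by rw [← pow_mul]
    _ ≤ (26 / 25 : ℝ) ^ m := pow_le_pow_right₀ (by norm_num) hm

/-- `r^q < 1/7` whenever `0 ≤ r < 1 - 2/q` (`q ≥ 2`): `(1 - 2/q)^q ≤ (e^{-2/q})^q = e⁻² < 1/7`
(`1 + x ≤ eˣ`, `e > 2.71828`). [folklore] -/
theorem pow_lt_one_div_seven {q : ℕ} (hq : 2 ≤ q) {r : ℝ} (hr : 0 ≤ r) (h : r < 1 - 2 / (q : ℝ)) :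
    r ^ q < 1 / 7 := by
  have hq0 : (q : ℝ) ≠ 0 := by positivity
  have h1 : r ^ q < (1 - 2 / (q : ℝ)) ^ q := pow_lt_pow_left₀ h hr (by omega)
  have h2 : (1 - 2 / (q : ℝ)) ^ q ≤ Real.exp (-2) := by
    have h3 : 1 - 2 / (q : ℝ) ≤ Real.exp (-2 / q) := by
      have := Real.add_one_le_exp (-2 / (q : ℝ))
      rwa [show -2 / (q : ℝ) + 1 = 1 - 2 / q by ring] at this
    have h4 : (0 : ℝ) ≤ 1 - 2 / q := hr.trans h.le
    calc (1 - 2 / (q : ℝ)) ^ q ≤ (Real.exp (-2 / q)) ^ q := pow_le_pow_left₀ h4 h3 q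
      _ = Real.exp (q * (-2 / q)) := (Real.exp_nat_mul _ _).symm
      _ = Real.exp (-2) := by
          congr 1
          field_simp
  have h5 : Real.exp (-2) < 1 / 7 := by
    rw [Real.exp_neg, one_div, inv_lt_inv₀ (Real.exp_pos 2) (by norm_num)]
    have h6 : Real.exp 2 = Real.exp 1 * Real.exp 1 := by
      rw [← Real.exp_add]
      norm_num
    have := Real.exp_one_gt_d9
    nlinarith
  linarith

/-- Splitting an inverse power along `q = (q - 6) + 6`: for `0 < a ≤ b` and `6 ≤ q`,
`b^{-q} ≤ a^{-(q-6)} b⁻⁶`. [folklore] -/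
theorem inv_pow_le_inv_pow_mul {q : ℕ} (hq : 6 ≤ q) {a b : ℝ} (ha : 0 < a) (hab : a ≤ b) :
    b⁻¹ ^ q ≤ a⁻¹ ^ (q - 6) * b⁻¹ ^ 6 := by
  obtain ⟨m, rfl⟩ : ∃ m, q = m + 6 := ⟨q - 6, by omega⟩
  rw [Nat.add_sub_cancel, pow_add]
  exact mul_le_mul_of_nonneg_right
    (pow_le_pow_left₀ (inv_nonneg.2 (ha.le.trans hab)) (inv_anti₀ ha hab) m) (by positivity)

/-! ## The separation bound -/

/-- **Ground states high on the Mie ladder are `(1 - 2/q)`-separated**: for `q ≥ 500`, every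
ground state `x` of `V_q = miePotential q` in `ℝ³` satisfies `|xᵢ - xⱼ| ≥ 1 - 2/q` for `i ≠ j`
(removal inequality at a closest pair + packing, twice; see the module docstring).
[cite: BlancLewin2015, §2.2] -/
theorem le_dist_of_isGroundState_miePotential {q : ℕ} (hq : 500 ≤ q) {N : ℕ}
    {x : Fin N → EuclideanSpace ℝ (Fin 3)} (hx : IsGroundState (miePotential q) x)
    {i j : Fin N} (hij : i ≠ j) : 1 - 2 / (q : ℝ) ≤ dist (x i) (x j) := by
  by_contra hlt
  rw [not_le] at hlt
  have hq0 : q ≠ 0 := by omega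
  have hq6 : 6 ≤ q := by omega
  have hqr : (q : ℝ) ≠ 0 := Nat.cast_ne_zero.2 hq0
  have hqpos : (0 : ℝ) < q := by positivity
  -- a closest pair `(i₀, j₀)`
  obtain ⟨p, hp, hmin⟩ := Finset.exists_min_image Finset.univ.offDiag
    (fun p : Fin N × Fin N => dist (x p.1) (x p.2)) ⟨(i, j), by simp [hij]⟩
  obtain ⟨i₀, j₀⟩ := p
  have hij₀ : i₀ ≠ j₀ := by simpa using hp
  set r := dist (x i₀) (x j₀) with hr_def
  have hr : 0 < r := dist_pos.2 (hx.1.ne hij₀)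
  have hsep : ∀ k l, k ≠ l → r ≤ dist (x k) (x l) := fun k l hkl => hmin (k, l) (by simp [hkl])
  have hrlt : r < 1 - 2 / (q : ℝ) := (hsep i j hij).trans_lt hlt
  have hr1 : r < 1 := hrlt.trans_le (by
    have : (0 : ℝ) ≤ 2 / q := by positivity
    linarith)
  -- notation: `T` = the other particles, `u k = |x_{i₀} - x_k|^{-q}`, `u₀ = r^{-q}`
  set T : Finset (Fin N) := Finset.univ.erase i₀ with hT
  have hj₀T : j₀ ∈ T := Finset.mem_erase.2 ⟨hij₀.symm, Finset.mem_univ _⟩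
  have hdk : ∀ k ∈ T, r ≤ dist (x i₀) (x k) := fun k hk =>
    hsep i₀ k (Finset.ne_of_mem_erase hk).symm
  set u : Fin N → ℝ := fun k => (dist (x i₀) (x k))⁻¹ ^ q with hu
  set u₀ : ℝ := r⁻¹ ^ q with hu₀
  have hu₀j : u j₀ = u₀ := rfl
  have hu₀pos : 0 < u₀ := by positivity
  have hunn : ∀ k, 0 ≤ u k := fun k => by positivity
  have hpowq : r⁻¹ ^ (q - 6) * r⁻¹ ^ 6 = u₀ := by
    rw [hu₀, ← pow_add, Nat.sub_add_cancel hq6]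
  -- (1) removal inequality: `∑_{k ∈ T} (u_k² - 2 u_k) ≤ 0`
  have hS : ∑ k ∈ T, (u k ^ 2 - 2 * u k) ≤ 0 := by
    have h := siteEnergy_nonpos (by norm_num) (neg_one_div_le_miePotential hq0)
      (fun s hs => miePotential_nonpos hq0 hs) hx i₀
    have hexp : ∀ k, miePotential q (dist (x i₀) (x k)) =
        1 / (2 * (q : ℝ)) * (u k ^ 2 - 2 * u k) := fun k => by
      simp only [hu, miePotential_apply, pow_mul']
      field_simp
    have hsite : siteEnergy (miePotential q) x i₀ =
        1 / (2 * (q : ℝ)) * ∑ k ∈ T, (u k ^ 2 - 2 * u k) := by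
      unfold siteEnergy
      rw [Finset.mul_sum]
      exact Finset.sum_congr rfl fun k _ => hexp k
    rw [hsite] at h
    have hpos : (0 : ℝ) < 1 / (2 * (q : ℝ)) := by positivity
    by_contra hcon
    exact absurd h (not_le.2 (mul_pos hpos (not_le.1 hcon)))
  -- (2) the shell sum and the crude bound `u₀ ≤ 500`
  have h6 : ∑ k ∈ T, (dist (x i₀) (x k))⁻¹ ^ 6 ≤ 250 * r⁻¹ ^ 6 := sum_inv_pow_six_le x hr hsep i₀
  have hsum_u : ∑ k ∈ T, u k ≤ 250 * u₀ :=
    calc ∑ k ∈ T, u k ≤ ∑ k ∈ T, r⁻¹ ^ (q - 6) * (dist (x i₀) (x k))⁻¹ ^ 6 :=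
          Finset.sum_le_sum fun k hk => inv_pow_le_inv_pow_mul hq6 hr (hdk k hk)
      _ = r⁻¹ ^ (q - 6) * ∑ k ∈ T, (dist (x i₀) (x k))⁻¹ ^ 6 := by rw [Finset.mul_sum]
      _ ≤ r⁻¹ ^ (q - 6) * (250 * r⁻¹ ^ 6) := mul_le_mul_of_nonneg_left h6 (by positivity)
      _ = 250 * u₀ := by rw [← hpowq]; ring
  have hsum_sq : u₀ ^ 2 ≤ ∑ k ∈ T, u k ^ 2 := by
    rw [← hu₀j]
    exact Finset.single_le_sum (f := fun k => u k ^ 2) (fun k _ => sq_nonneg (u k)) hj₀T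
  have hsplit2 : ∑ k ∈ T, (u k ^ 2 - 2 * u k) = ∑ k ∈ T, u k ^ 2 - 2 * ∑ k ∈ T, u k := by
    rw [Finset.sum_sub_distrib, Finset.mul_sum]
  have hcrude : u₀ ≤ 500 := by nlinarith
  -- (3) hence `r ≥ 49/50`
  have hr49 : 49 / 50 ≤ r := by
    by_contra h
    rw [not_le] at h
    have h1 : (50 : ℝ) / 49 < r⁻¹ := by
      rw [lt_inv_comm₀ (by norm_num) hr]
      have : ((50 : ℝ) / 49)⁻¹ = 49 / 50 := by norm_num
      linarith
    have h2 : (1024 : ℝ) ≤ (50 / 49 : ℝ) ^ q := le_pow_fifty_div q (by omega)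
    have h3 : (50 / 49 : ℝ) ^ q < r⁻¹ ^ q := pow_lt_pow_left₀ h1 (by norm_num) hq0
    have h4 : r⁻¹ ^ q = u₀ := rfl
    linarith
  have hinv_r : r⁻¹ ≤ 50 / 49 := by
    rw [inv_le_comm₀ hr (by norm_num)]
    have : ((50 : ℝ) / 49)⁻¹ = 49 / 50 := by norm_num
    linarith
  -- (4) the pair `(i₀, j₀)` alone contributes `u₀² - 2u₀ > 35`
  have hu₀7 : 7 < u₀ := by
    have h1 : r ^ q < 1 / 7 := pow_lt_one_div_seven (by omega) hr.le hrlt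
    have h2 : u₀ = (r ^ q)⁻¹ := by rw [hu₀, inv_pow]
    rw [h2, lt_inv_comm₀ (by norm_num) (pow_pos hr q)]
    have : (7 : ℝ)⁻¹ = 1 / 7 := by norm_num
    linarith
  have hf₀ : 35 < u₀ ^ 2 - 2 * u₀ := by nlinarith
  -- (5) every other particle contributes `≥ -1` (near) or `≥ -2 (25/26)^{q-6} |x_{i₀} - x_k|⁻⁶` (far)
  set R₁ : ℝ := 26 / 25 with hR₁
  set T' : Finset (Fin N) := T.erase j₀ with hT'
  have hterm : ∀ k ∈ T', -((if dist (x i₀) (x k) ≤ R₁ then (1 : ℝ) else 0) +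
      2 * (R₁⁻¹ ^ (q - 6) * (dist (x i₀) (x k))⁻¹ ^ 6)) ≤ u k ^ 2 - 2 * u k := by
    intro k hk
    have hnn : 0 ≤ R₁⁻¹ ^ (q - 6) * (dist (x i₀) (x k))⁻¹ ^ 6 := by positivity
    by_cases hnear : dist (x i₀) (x k) ≤ R₁
    · rw [if_pos hnear]
      nlinarith [sq_nonneg (u k - 1)]
    · rw [if_neg hnear]
      have hfar : R₁ ≤ dist (x i₀) (x k) := (not_le.1 hnear).le
      have hule : u k ≤ R₁⁻¹ ^ (q - 6) * (dist (x i₀) (x k))⁻¹ ^ 6 :=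
        inv_pow_le_inv_pow_mul hq6 (by norm_num) hfar
      nlinarith [hunn k, sq_nonneg (u k)]
  have h6' : ∑ k ∈ T', (dist (x i₀) (x k))⁻¹ ^ 6 ≤ 250 * r⁻¹ ^ 6 :=
    (Finset.sum_le_sum_of_subset_of_nonneg (Finset.erase_subset j₀ T)
      (fun k _ _ => by positivity)).trans h6
  have hsumT' : -(((T'.filter fun k => dist (x i₀) (x k) ≤ R₁).card : ℝ) +
      2 * (R₁⁻¹ ^ (q - 6) * (250 * r⁻¹ ^ 6))) ≤ ∑ k ∈ T', (u k ^ 2 - 2 * u k) := by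
    refine le_trans ?_ (Finset.sum_le_sum hterm)
    rw [Finset.sum_neg_distrib, Finset.sum_add_distrib, Finset.sum_boole, ← Finset.mul_sum,
      ← Finset.mul_sum, neg_le_neg_iff]
    have hR0 : (0 : ℝ) ≤ R₁⁻¹ ^ (q - 6) := by positivity
    nlinarith [mul_le_mul_of_nonneg_left h6' hR0]
  have hsplitT : ∑ k ∈ T, (u k ^ 2 - 2 * u k) =
      (u₀ ^ 2 - 2 * u₀) + ∑ k ∈ T', (u k ^ 2 - 2 * u k) := by
    rw [← Finset.add_sum_erase T _ hj₀T]
  -- (6) packing: at most `(2 R₁ / r + 1)³ - 2` near particles besides `i₀`, `j₀`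
  set A : Finset (Fin N) := Finset.univ.filter fun k => dist (x i₀) (x k) ≤ R₁ with hA
  have hAcard : (A.card : ℝ) ≤ (2 * R₁ / r + 1) ^ 3 := by
    have key := card_le_of_separated_of_dist_le (A.image x) (x i₀) hr
      (by norm_num : (0 : ℝ) ≤ R₁) ?_ ?_
    · rw [finrank_euclideanSpace_fin, Finset.card_image_of_injective _ hx.1] at key
      exact key
    · intro c hc
      obtain ⟨k, hk, rfl⟩ := Finset.mem_image.1 hc
      rw [dist_comm]
      exact (Finset.mem_filter.1 hk).2
    · intro c hc c' hc' hne
      obtain ⟨k, -, rfl⟩ := Finset.mem_image.1 hc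
      obtain ⟨l, -, rfl⟩ := Finset.mem_image.1 hc'
      exact hsep k l fun h => hne (h ▸ rfl)
  have hi₀A : i₀ ∈ A := by
    refine Finset.mem_filter.2 ⟨Finset.mem_univ _, ?_⟩
    rw [dist_self]
    norm_num
  have hj₀A : j₀ ∈ A.erase i₀ := by
    refine Finset.mem_erase.2 ⟨hij₀.symm, Finset.mem_filter.2 ⟨Finset.mem_univ _, ?_⟩⟩
    show r ≤ R₁
    rw [hR₁]
    linarith
  have hfilt : T'.filter (fun k => dist (x i₀) (x k) ≤ R₁) = (A.erase i₀).erase j₀ := by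
    rw [hT', hT, Finset.filter_erase, Finset.filter_erase]
  have hcardT' : (((T'.filter fun k => dist (x i₀) (x k) ≤ R₁).card : ℝ) + 2 = A.card) := by
    have h1 := Finset.card_erase_add_one hj₀A
    have h2 := Finset.card_erase_add_one hi₀A
    rw [hfilt]
    norm_cast
    omega
  -- (7) numerics
  have hP : (2 * R₁ / r + 1) ^ 3 ≤ (30.45 : ℝ) := by
    have h1 : 2 * R₁ / r + 1 ≤ 2 * (26 / 25) * (50 / 49) + 1 := by
      rw [div_eq_mul_inv, hR₁]
      nlinarith
    calc (2 * R₁ / r + 1) ^ 3 ≤ (2 * (26 / 25) * (50 / 49) + 1 : ℝ) ^ 3 :=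
          pow_le_pow_left₀ (by positivity) h1 3
      _ ≤ 30.45 := by norm_num
  have hr6 : r⁻¹ ^ 6 ≤ (113 / 100 : ℝ) :=
    calc r⁻¹ ^ 6 ≤ (50 / 49 : ℝ) ^ 6 := pow_le_pow_left₀ (inv_nonneg.2 hr.le) hinv_r 6
      _ ≤ 113 / 100 := by norm_num
  have hR₁pow : R₁⁻¹ ^ (q - 6) ≤ 1 / 256 := by
    have h1 : (256 : ℝ) ≤ (26 / 25 : ℝ) ^ (q - 6) := le_pow_twentySix_div (q - 6) (by omega)
    rw [hR₁, inv_pow, one_div, inv_le_inv₀ (by positivity) (by norm_num)]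
    exact h1
  have hprod : R₁⁻¹ ^ (q - 6) * (250 * r⁻¹ ^ 6) ≤ 1 / 256 * (250 * (113 / 100)) :=
    mul_le_mul hR₁pow (by linarith) (by positivity) (by norm_num)
  -- (8) contradiction
  linarith [hS, hsplitT, hsumT', hAcard, hcardT', hP, hprod, hf₀]

end LadderGroundStates

end Summit.AtomisticToContinuum.Crystallization.Theorems

end
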